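import Literature.Topology.FourManifolds.GompfConePaths
import HarnessLib

/-!
# The two straightening classes of a framing path differ by the axis rotation loop

Fourth infrastructure file for the framed form of Gompf's Theorem 2.1
(`Literature.Topology.FourManifolds.gompf2010_framedTwist`; R. Gompf, *More Cappell–Shaneson
spheres are standard*, Algebr. Geom. Topol. 10 (2010)). Gompf, §4 after Def. 4.1: "there are
exactly two straightenings of `A`, differing by an element of `π₁(GL(V)) = ℤ/2`". The tree proves
`π₁(GL⁺(3, ℝ)) = ℤ/2` (`fundamentalGroup_posDetMatrix_three_holds`) and the essentiality of one
particular loop (Gompf's `τ·ρ`, `gompf2010_framingLoop_essential_holds`); the forthcoming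
construction of the *axis twist* of a straightening (precomposing a based diffeotopy of `T³`
with a full turn of the normal plane of the first coordinate axis) multiplies the framing path
pointwise by a conjugate of the **rotation loop about the first axis**. This file supplies the
homotopy theory of that operation, entirely proved:

* `Literature.Topology.FourManifolds.square_false_rotX` — the rotation loop about the *first* axis
  is essential in `GL₃(ℝ)` (square form), from the tree's
  `Literature.AlgebraicTopology.FundamentalGroup.RotLoop.square_false` (rotation about the second
  axis) by conjugation with the cyclic permutation matrix `cycPerm` of `GompfConePaths.lean`
  (which runs the same argument for its uniform turn `coneTurn`; here in reusable square form);
* `Literature.Topology.FourManifolds.rotXTurn μ` — the loop `θ ↦ Rₓ(2π μ(θ))` in `GL₃(ℝ)` for a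
  continuous `μ` with `μ 0 = 1`, `μ 1 = 0` (one full turn, run backwards along any time profile),
  and `Literature.Topology.FourManifolds.not_homotopic_rotXTurn_refl`: it is not null-homotopic
  (straight-line reparametrisation to the reversed standard loop, then the square form);
* `Literature.Topology.FourManifolds.PosDetMatrix.not_homotopic_of_mul_conj_rotXTurn` — **division
  lemma**: if `q(θ) = p(θ) · (C⁻¹ Rₓ(2π μ(θ)) C)` pointwise for paths `p, q` from `1` to `x` in
  `GL⁺(3, ℝ)`, then `p` and `q` are *not* homotopic rel end points (a homotopy `H` would give the
  null-homotopy `(s, θ) ↦ C p(θ)⁻¹ H(s, θ) C⁻¹` of the turn);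
* `Literature.Topology.FourManifolds.SmoothMatrixPath.not_homotopic_of_mul_conj_rotX` and
  `Literature.Topology.FourManifolds.SmoothMatrixPath.homotopic_or_homotopic_of_mul_conj_rotX` — for
  smooth framing paths `γ, γ'` from `1` to `A ∈ SL(3, ℤ)` related in this way, `[γ] ≠ [γ']`, and
  consequently (pigeonhole in `π₁ = ℤ/2`, `quotient_eq_or_eq_of_card_eq_two`) **every** framing path
  of `A` is homotopic to `γ` or to `γ'`: the two straightening classes of Gompf's Def. 4.1 are
  `[γ]` and `[γ']`.

No named facts are introduced.

## References

* R. E. Gompf, *More Cappell–Shaneson spheres are standard*, Algebr. Geom. Topol. 10 (2010)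
  1665–1681: §4, Def. 4.1 and the sentence following it. [GompfAGT2010]
* A. Hatcher, *Algebraic Topology* (2002), §3.D (`π₁(SO(3)) = ℤ₂`, generated by a rotation
  loop). [HatcherAT2002]
-/

noncomputable section

open scoped unitInterval
open Set Function Matrix Topology
open Literature.AlgebraicTopology.FundamentalGroup
open Literature.AlgebraicTopology.FundamentalGroup.RotLoop

namespace Literature.Topology.FourManifolds

/-! ### The rotation loop about the first axis is essential -/

section RotX

/-- `Sᵀ S = 1` for the cyclic permutation matrix `S = cycPerm` of `GompfConePaths.lean`. [folklore] -/
theorem cycPerm_transpose_mul : cycPermᵀ * cycPerm = 1 :=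
  mul_eq_one_comm.1 cycPerm_mul_transpose

/-- `det (S M Sᵀ) = det M`. [folklore] -/
theorem det_cycPerm_conj (M : Matrix (Fin 3) (Fin 3) ℝ) :
    (cycPerm * M * cycPermᵀ).det = M.det := by
  rw [det_mul, det_mul, mul_comm, ← mul_assoc, ← det_mul, cycPerm_transpose_mul, det_one, one_mul]

/-- **The rotation loop about the first axis is essential in `GL₃(ℝ)` (square form)**: there is
no continuous `G : I² → GL₃(ℝ)` with boundary values `Rₓ(bc y, bs y)` (one full turn along the
bottom edge, the identity on the other three edges). From `RotLoop.square_false 0` by conjugation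
with the cyclic permutation. [cite: HatcherAT2002, §3.D (π₁(SO(n)) = ℤ₂ for n ≥ 3) and §4.2 Example 4.55] -/
theorem square_false_rotX {G : (Fin 2 → I) → Matrix (Fin 3) (Fin 3) ℝ} (hG : Continuous G)
    (hdet : ∀ y, (G y).det ≠ 0)
    (hbd : ∀ y ∈ Cube.boundary (Fin 2), G y = rotX (bc y) (bs y)) : False := by
  refine square_false 0 (G := fun y ↦ cycPerm * G y * cycPermᵀ)
    ((continuous_const.mul hG).mul continuous_const) (fun y ↦ ?_) fun y hy ↦ ?_
  · rw [det_cycPerm_conj]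
    exact hdet y
  · show cycPerm * G y * cycPermᵀ = rotY (bc y) (bs y)
    rw [hbd y hy, cycPerm_mul_rotX_mul_transpose]

/-- The rotation about the first axis by the angle `2π m`, as an element of `GL₃(ℝ)`. [folklore] -/
def rotXGL (m : ℝ) : GLMat 3 :=
  ⟨rotX (Real.cos (2 * Real.pi * m)) (Real.sin (2 * Real.pi * m)), by
    rw [rotX, Matrix.det_fin_three]
    simp
    nlinarith [Real.cos_sq_add_sin_sq (2 * Real.pi * m)]⟩

/-- Values of `rotXGL`. [folklore] -/
@[simp] theorem coe_rotXGL (m : ℝ) :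
    (rotXGL m).1 = rotX (Real.cos (2 * Real.pi * m)) (Real.sin (2 * Real.pi * m)) := rfl

/-- `rotXGL` is continuous. [folklore] -/
theorem continuous_rotXGL : Continuous rotXGL := by
  refine Continuous.subtype_mk ?_ _
  refine continuous_matrix fun i j ↦ ?_
  fin_cases i <;> fin_cases j <;> simp [rotX] <;> fun_prop

/-- At integers `rotXGL` is the identity. [folklore] -/
theorem rotXGL_intCast (k : ℤ) : rotXGL k = GLMat.one 3 := by
  apply Subtype.ext
  have hc : Real.cos (2 * Real.pi * (k : ℝ)) = 1 := by
    rw [show 2 * Real.pi * (k : ℝ) = (k : ℝ) * (2 * Real.pi) by ring]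
    exact Real.cos_int_mul_two_pi k
  have hs : Real.sin (2 * Real.pi * (k : ℝ)) = 0 := by
    rw [show 2 * Real.pi * (k : ℝ) = ((2 * k : ℤ) : ℝ) * Real.pi by push_cast; ring]
    exact Real.sin_int_mul_pi (2 * k)
  rw [coe_rotXGL, hc, hs]
  show rotX 1 0 = 1
  ext i j
  fin_cases i <;> fin_cases j <;> simp [rotX]

/-- `rotXGL 0 = 1`. [folklore] -/
@[simp] theorem rotXGL_zero : rotXGL 0 = GLMat.one 3 := by exact_mod_cast rotXGL_intCast 0

/-- `rotXGL 1 = 1`. [folklore] -/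
@[simp] theorem rotXGL_one : rotXGL 1 = GLMat.one 3 := by exact_mod_cast rotXGL_intCast 1

/-- **The standard rotation loop about the first axis** `x ↦ Rₓ(2πx)` in `GL₃(ℝ)`. [cite: HatcherAT2002, §3.D (π₁(SO(n)) for n ≥ 3, generated by a rotation loop)] -/
def rotXLoopGL : Path (GLMat.one 3) (GLMat.one 3) where
  toFun x := rotXGL x
  continuous_toFun := continuous_rotXGL.comp continuous_subtype_val
  source' := by simp
  target' := by simp

/-- Values of the rotation loop. [folklore] -/
@[simp] theorem rotXLoop_apply (x : I) : rotXLoopGL x = rotXGL x := rfl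

/-- **The rotation loop about the first axis is not null-homotopic in `GL₃(ℝ)`.** [cite: HatcherAT2002, §3.D (π₁(SO(n)) = ℤ₂ for n ≥ 3) and §4.2 Example 4.55] -/
theorem not_homotopic_rotXLoop_refl : ¬ rotXLoopGL.Homotopic (Path.refl _) := by
  rintro ⟨F⟩
  refine square_false_rotX (G := fun y ↦ (F (y 1, y 0)).1) ?_ (fun y ↦ (F (y 1, y 0)).2) ?_
  · exact continuous_subtype_val.comp (F.continuous.comp (by fun_prop))
  · intro y hy
    by_cases h : y 1 = 0
    · obtain ⟨h1, h2⟩ := bc_bs_of_bottom h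
      rw [h1, h2, h]
      show (F (0, y 0)).1 = _
      rw [F.apply_zero]
      rfl
    · obtain ⟨h1, h2⟩ := bc_bs_of_not_bottom hy h
      rw [h1, h2, show rotX 1 0 = (GLMat.one 3).1 by
        show rotX 1 0 = 1; ext i j; fin_cases i <;> fin_cases j <;> simp [rotX]]
      rcases Fin.exists_fin_two.1 hy with hi | hi
      · have hx : y 0 ∈ ({0, 1} : Set I) := by
          rcases hi with h0 | h0
          · exact Or.inl h0
          · exact Or.inr h0
        show (F (y 1, y 0)).1 = (GLMat.one 3).1
        rw [F.eq_fst (y 1) hx]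
        rcases hi with h0 | h0
        · rw [h0]; show (rotXLoopGL 0).1 = _; rw [rotXLoopGL.source]
        · rw [h0]; show (rotXLoopGL 1).1 = _; rw [rotXLoopGL.target]
      · rcases hi with h1' | h1'
        · exact absurd h1' h
        · rw [h1']
          show (F (1, y 0)).1 = (GLMat.one 3).1
          rw [F.apply_one]
          rfl

end RotX

/-! ### One full turn along an arbitrary time profile -/

section Turn

variable (μ : I → ℝ) (hμ : Continuous μ) (h0 : μ 0 = 1) (h1 : μ 1 = 0)

/-- **A full turn run backwards along the profile `μ`**: the loop `θ ↦ Rₓ(2π μ(θ))` in `GL₃(ℝ)`,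
`μ 0 = 1`, `μ 1 = 0`. [folklore] -/
def rotXTurn : Path (GLMat.one 3) (GLMat.one 3) where
  toFun θ := rotXGL (μ θ)
  continuous_toFun := continuous_rotXGL.comp hμ
  source' := by rw [h0, rotXGL_one]
  target' := by rw [h1, rotXGL_zero]

/-- Values of the turn. [folklore] -/
@[simp] theorem rotXTurn_apply (θ : I) : rotXTurn μ hμ h0 h1 θ = rotXGL (μ θ) := rfl

include h0 h1 in
/-- **The turn is homotopic to the reversed standard loop** (straight-line interpolation of the
time profiles `μ` and `θ ↦ 1 - θ`, which have the same end values). [folklore] -/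
theorem rotXTurn_homotopic_symm : (rotXTurn μ hμ h0 h1).Homotopic rotXLoopGL.symm := by
  refine ⟨{ toFun := fun st ↦ rotXGL ((1 - (st.1 : ℝ)) * μ st.2 + (st.1 : ℝ) * (1 - (st.2 : ℝ)))
            continuous_toFun := continuous_rotXGL.comp (by fun_prop)
            map_zero_left := fun θ ↦ by simp
            map_one_left := fun θ ↦ by simp [Path.symm, unitInterval.symm]
            prop' := fun s θ hθ ↦ ?_ }⟩
  simp only [Set.mem_insert_iff, Set.mem_singleton_iff] at hθ
  rcases hθ with rfl | rfl
  · show rotXGL ((1 - (s : ℝ)) * μ 0 + (s : ℝ) * (1 - ((0 : I) : ℝ))) = rotXGL (μ 0)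
    rw [h0]; norm_num
  · show rotXGL ((1 - (s : ℝ)) * μ 1 + (s : ℝ) * (1 - ((1 : I) : ℝ))) = rotXGL (μ 1)
    rw [h1]; norm_num

include h0 h1 in
/-- **The turn is not null-homotopic in `GL₃(ℝ)`.** [cite: HatcherAT2002, §3.D (π₁(SO(n)) = ℤ₂ for n ≥ 3) and §4.2 Example 4.55] -/
theorem not_homotopic_rotXTurn_refl : ¬ (rotXTurn μ hμ h0 h1).Homotopic (Path.refl _) := by
  intro h
  have h' : rotXLoopGL.symm.Homotopic (Path.refl _) := (rotXTurn_homotopic_symm μ hμ h0 h1).symm.trans h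
  have h'' : rotXLoopGL.Homotopic (Path.refl _) := by
    have := h'.symm₂
    rwa [Path.symm_symm, Path.refl_symm] at this
  exact not_homotopic_rotXLoop_refl h''

end Turn

/-! ### Division lemma in `GL⁺(3, ℝ)` -/

section Division

variable {x : PosDetMatrix 3}

/-- The explicit inverse `det⁻¹ · adj` of a path of positive-determinant matrices. [folklore] -/
def pathInv (p : Path (1 : PosDetMatrix 3) x) (θ : I) : Matrix (Fin 3) (Fin 3) ℝ :=
  ((p θ).1.det)⁻¹ • (p θ).1.adjugate

/-- `p(θ)⁻¹ p(θ) = 1`. [folklore] -/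
theorem pathInv_mul (p : Path (1 : PosDetMatrix 3) x) (θ : I) : pathInv p θ * (p θ).1 = 1 := by
  rw [pathInv, Matrix.smul_mul, Matrix.adjugate_mul, smul_smul, inv_mul_cancel₀ (p θ).2.ne',
    one_smul]

/-- `p(θ) p(θ)⁻¹ = 1`. [folklore] -/
theorem mul_pathInv (p : Path (1 : PosDetMatrix 3) x) (θ : I) : (p θ).1 * pathInv p θ = 1 := by
  rw [pathInv, Matrix.mul_smul, Matrix.mul_adjugate, smul_smul, inv_mul_cancel₀ (p θ).2.ne',
    one_smul]

/-- `p(θ)⁻¹ (p(θ) M) = M`. [folklore] -/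
theorem pathInv_mul_cancel_left (p : Path (1 : PosDetMatrix 3) x) (θ : I)
    (M : Matrix (Fin 3) (Fin 3) ℝ) : pathInv p θ * ((p θ).1 * M) = M := by
  rw [← Matrix.mul_assoc, pathInv_mul, Matrix.one_mul]

/-- The inverse path is continuous. [folklore] -/
theorem continuous_pathInv (p : Path (1 : PosDetMatrix 3) x) : Continuous (pathInv p) := by
  have hc : Continuous fun θ ↦ (p θ).1 := continuous_subtype_val.comp p.continuous
  exact (hc.matrix_det.inv₀ fun θ ↦ (p θ).2.ne').smul hc.matrix_adjugate

/-- `det (p(θ)⁻¹) ≠ 0`. [folklore] -/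
theorem det_pathInv_ne_zero (p : Path (1 : PosDetMatrix 3) x) (θ : I) : (pathInv p θ).det ≠ 0 := by
  intro h
  have := congrArg Matrix.det (pathInv_mul p θ)
  rw [det_mul, h, zero_mul, det_one] at this
  exact zero_ne_one this

variable (C Cinv : Matrix (Fin 3) (Fin 3) ℝ) (hC : C * Cinv = 1)

include hC in
/-- **Division lemma.** Let `p, q` be paths from `1` to `x` in `GL⁺(3, ℝ)` with
`q(θ) = p(θ) · (C⁻¹ Rₓ(2π μ(θ)) C)` pointwise, `μ` continuous with `μ 0 = 1`, `μ 1 = 0`. Then `p`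
and `q` are not homotopic rel end points: a homotopy `H` from `p` to `q` yields the null-homotopy
`(s, θ) ↦ C p(θ)⁻¹ H(s, θ) C⁻¹` of the full turn `θ ↦ Rₓ(2π μ(θ))` in `GL₃(ℝ)`. (Gompf, §4 after
Def. 4.1: the two straightenings differ by the generator of `π₁(GL(V)) = ℤ/2`.) [cite: GompfAGT2010, §4 (after Def. 4.1: exactly two straightenings, differing by an element of π₁(GL(V)) = ℤ/2)] -/
theorem PosDetMatrix.not_homotopic_of_mul_conj_rotXTurn (p q : Path (1 : PosDetMatrix 3) x)
    (μ : I → ℝ) (hμ : Continuous μ) (h0 : μ 0 = 1) (h1 : μ 1 = 0)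
    (hq : ∀ θ, (q θ).1 = (p θ).1 * (Cinv * (rotXGL (μ θ)).1 * C)) : ¬ p.Homotopic q := by
  rintro ⟨H⟩
  apply not_homotopic_rotXTurn_refl μ hμ h0 h1
  -- the null-homotopy `K(s, θ) = C p(θ)⁻¹ H(s, θ) C⁻¹`, from the turn (`s = 1`) to `1` (`s = 0`)
  have hK1 : ∀ θ, C * (pathInv p θ * (p θ).1) * Cinv = 1 := fun θ ↦ by
    rw [pathInv_mul, Matrix.mul_one, hC]
  refine ⟨Path.Homotopy.symm (p₀ := Path.refl _) (p₁ := rotXTurn μ hμ h0 h1) ?_⟩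
  refine
    { toFun := fun st ↦ ⟨C * (pathInv p st.2 * (H st).1) * Cinv, ?_⟩
      continuous_toFun := ?_
      map_zero_left := fun θ ↦ ?_
      map_one_left := fun θ ↦ ?_
      prop' := fun s θ hθ ↦ ?_ }
  · rw [det_mul, det_mul, det_mul]
    refine mul_ne_zero (mul_ne_zero ?_ (mul_ne_zero (det_pathInv_ne_zero p _) (H st).2.ne')) ?_
    · intro h
      have := congrArg Matrix.det hC
      rw [det_mul, h, zero_mul, det_one] at this
      exact zero_ne_one this
    · intro h
      have := congrArg Matrix.det hC
      rw [det_mul, h, mul_zero, det_one] at this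
      exact zero_ne_one this
  · refine Continuous.subtype_mk ?_ _
    exact ((continuous_const.mul (((continuous_pathInv p).comp continuous_snd).mul
      (continuous_subtype_val.comp H.continuous))).mul continuous_const)
  · apply Subtype.ext
    show C * (pathInv p θ * (H (0, θ)).1) * Cinv = 1
    rw [H.apply_zero]
    exact hK1 θ
  · apply Subtype.ext
    show C * (pathInv p θ * (H (1, θ)).1) * Cinv = (rotXGL (μ θ)).1
    rw [H.apply_one, show (q.toContinuousMap θ) = q θ from rfl, hq θ, pathInv_mul_cancel_left]
    calc C * (Cinv * (rotXGL (μ θ)).1 * C) * Cinv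
        = (C * Cinv) * (rotXGL (μ θ)).1 * (C * Cinv) := by simp only [Matrix.mul_assoc]
      _ = (rotXGL (μ θ)).1 := by rw [hC, Matrix.one_mul, Matrix.mul_one]
  · apply Subtype.ext
    show C * (pathInv p θ * (H (s, θ)).1) * Cinv = ((Path.refl (GLMat.one 3)) θ).1
    simp only [Set.mem_insert_iff, Set.mem_singleton_iff] at hθ
    have hθ' : θ ∈ ({0, 1} : Set I) := by
      rcases hθ with rfl | rfl
      · exact Or.inl rfl
      · exact Or.inr rfl
    rw [H.eq_fst s hθ', show (p.toContinuousMap θ) = p θ from rfl]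
    exact hK1 θ

end Division

/-! ### The two classes of framing paths of `A ∈ SL(3, ℤ)` -/

namespace SmoothMatrixPath

variable {A : Matrix.SpecialLinearGroup (Fin 3) ℤ} (γ γ' : SmoothMatrixPath (slRealMatrix A))
  (μ : ℝ → ℝ) (hμ : Continuous μ) (h0 : μ 0 = 1) (h1 : μ 1 = 0)
  (hγ' : ∀ θ, γ'.toFun θ = γ.toFun θ * (slRealMatrix A⁻¹ *
    rotX (Real.cos (2 * Real.pi * μ θ)) (Real.sin (2 * Real.pi * μ θ)) * slRealMatrix A))

include hμ h0 h1 hγ' in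
/-- **Twisting a framing path by the (conjugated, reprofiled) axis rotation loop changes its
class**: if `γ'(θ) = γ(θ) · A⁻¹ Rₓ(2π μ(θ)) A` with `μ 0 = 1`, `μ 1 = 0`, then `[γ] ≠ [γ']` as paths
from `1` to `A` in `GL⁺(3, ℝ)`. [cite: GompfAGT2010, §4 (after Def. 4.1: exactly two straightenings, differing by an element of π₁(GL(V)) = ℤ/2)] -/
theorem not_homotopic_of_mul_conj_rotX : ¬ γ.toPath.Homotopic γ'.toPath :=
  PosDetMatrix.not_homotopic_of_mul_conj_rotXTurn (slRealMatrix A) (slRealMatrix A⁻¹)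
    (slRealMatrix_mul_inv A) γ.toPath γ'.toPath (fun θ ↦ μ θ)
    (hμ.comp continuous_subtype_val) h0 h1 fun θ ↦ hγ' θ

include hμ h0 h1 hγ' in
/-- **The two straightening classes.** With `γ, γ'` as above, every smooth framing path `δ` from
`1` to `A` is homotopic to `γ` or to `γ'` (pigeonhole: `π₁(GL⁺(3, ℝ), 1)` has two elements,
`fundamentalGroup_posDetMatrix_three_holds`, and `[γ] ≠ [γ']`). Gompf, §4: "there are exactly two
straightenings". [cite: GompfAGT2010, §4 (after Def. 4.1: exactly two straightenings, differing by an element of π₁(GL(V)) = ℤ/2)] -/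
theorem homotopic_or_homotopic_of_mul_conj_rotX (δ : SmoothMatrixPath (slRealMatrix A)) :
    δ.toPath.Homotopic γ.toPath ∨ δ.toPath.Homotopic γ'.toPath := by
  have hne : Path.Homotopic.Quotient.mk γ.toPath ≠ Path.Homotopic.Quotient.mk γ'.toPath := by
    intro h
    exact not_homotopic_of_mul_conj_rotX γ γ' μ hμ h0 h1 hγ' (Path.Homotopic.Quotient.eq.1 h)
  rcases quotient_eq_or_eq_of_card_eq_two fundamentalGroup_posDetMatrix_three_holds hne
    (Path.Homotopic.Quotient.mk δ.toPath) with h | h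
  · exact Or.inl (Path.Homotopic.Quotient.eq.1 h)
  · exact Or.inr (Path.Homotopic.Quotient.eq.1 h)

end SmoothMatrixPath

end Literature.Topology.FourManifolds
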